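import Summits.BirchSwinnertonDyer.BirchSwinnertonDyer.Theses.SemiOrdinaryEisensteinDescent
import Summits.BirchSwinnertonDyer.BirchSwinnertonDyer.Theorems.SemiOrdinaryEisensteinDescentEisensteinKernelAtThreeRestrictedOfFrameOdd
import Summits.BirchSwinnertonDyer.BirchSwinnertonDyer.Theorems.AdditiveRankOneControlLeOfPoitouTate
import HarnessLib

/-!
# Route `SemiOrdinaryEisensteinDescent`, support item `EisensteinKernelAtThreeTowerFreeOdd`
# (stmt-BirchSwinnertonDyer-24697): THE `closes` KERNEL‴ = TOWER-FREE ⊕ ODD-`d_K` ⊕ PT1 — published inputs →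
# restricted Eisenstein inclusion `E′` → tower-free Kolyvagin upper bound `Ko′` → printed-inputs package
# (Hsieh ∧ BDP13 ∧ LZZ) → `R₀`-frame at odd `d_K` from print → Poitou–Tate duality PT1 → rank-zero twist ⟹ the leaf, PROVED

Cell `bsd-wall` (W-ALL, row 2·3@3 lane 3), width seat `bsd-wall-soed-p1-w3` (gen 6), 2026-08-28, on the route
pen's text (planner bsd-wall-pss3x g2, SOED edit of 2026-08-28T02:10:15Z): `closes (hIn hE' hKo hW hS hPT hZ hK)`
with `hK : EisensteinKernelAtThreeTowerFreeOdd` — no V (#4), no C (#5), no NT (#7) sockets. Closes the support item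
`EisensteinKernelAtThreeTowerFreeOdd` of route `route-BirchSwinnertonDyer-SemiOrdinaryEisensteinDescent`: the theorem
below has LITERALLY the type
`Summit.BirchSwinnertonDyer.BirchSwinnertonDyer.Theses.SemiOrdinaryEisensteinDescent.EisensteinKernelAtThreeTowerFreeOdd`.

PROOF = the item's recipe, a mechanical merge of two landed verbatim variants of bed-p3 g1's kernel (p588074 §3 for
`E′`): this seat's `…RestrictedOfControlLe.wAllExclAddWildRankOneSurj_of_restricted_of_frameOdd_of_poitouTate`
(p595286: crux #4 ↦ one `R₀`-frame at the Friedberg–Hoffstein field, value forced by LZZ — p594734 §1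
`exists_unit_hasValueAt_of_frame`; crux #5 ↦ the control INEQUALITY from PT1 alone — utd-p3 g6 p593079 §2/§3) with
step (o) DELETED (no `TowerSurjThree` case split, no NT call) and the tower-free Kolyvagin crux `Ko′`
(`WildKolyvaginUpperAtThreeTowerFree`, 24696) called where Ko was called with `htower` — the surgery of soed-p2's
p594519 `EisensteinKernelAtThreeTowerFree.wAllExclAddWildRankOneSurj_of_koTowerFree`. Steps: parity; Friedberg–Hoffstein
with modulus `2` (so `d_K ≡ 1 (mod 8)` is odd; all of `N` split, so `d_K ≠ -3`); Heegner point, Gross–Zagier,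
Kolyvagin for the datum; frame `(κ, γ, 𝔭, 𝔭′)`; the package `⟨Hsieh, BDP13, LZZ⟩` feeds the frame item at `(κ, γ, 𝔭)`
and LZZ forces its unit value; `≤`-control + CTL₀ at `𝔭′` from PT1; `E′` at the frame ⟹ T-B6-1 at slack `v₃(c)`;
`≤`-link ⟹ STEP L; `Ko′` ⟹ the upper socket at the same slack; p528981 on a minimal model of the twist with Z.

HONEST FRAMING: this closes a SUPPORT item (pure assembly); every crux of the route on the deciding chain
(`WildSplitEisensteinInclusionAtThreeRestricted` 24155, `WildKolyvaginUpperAtThreeTowerFree` 24696,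
`WildRankZeroTwistAtThree` 20387), the frame item `WildSplitFrameAtThreeOddOfPrint` (24475, the cn100 port), the
package 24476 and PT1 (20461) are ANTECEDENTS of the statement proved; `E′` has no engine in print (walls W1–W3 of the
leads' census). BSD is not proved for any curve by this file. No definition, no named fact, no `sorry`.

References: [JetchevSkinnerWan2017] Thm. 3.3.1, §7.4.1 (arXiv:1512.06894 pp. 11, 30); [LiuZhangZhang2018] Thm 1.5.1,
Thm 1.5.3; [MilneADT2006] I Thm. 4.10(b); [Castella2018] Thm. 2.3, §5; [GrossZagier1986] Thm. I.(6.3), V.§2;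
[FriedbergHoffstein1995] Thm. B; [McCallumLMS1991] §3; [Kolyvagin1990] Thm. A.
-/

noncomputable section

open scoped Classical NumberField

set_option linter.dupNamespace false -- `Summit.BirchSwinnertonDyer.BirchSwinnertonDyer.Theorems.…` (summit = sub, D-0017)
set_option autoImplicit false

namespace Summit.BirchSwinnertonDyer.BirchSwinnertonDyer.Theorems

open WeierstrassCurve NumberField IsDedekindDomain Field PowerSeries
  Literature.NumberTheory.EllipticCurves
  Literature.NumberTheory.EllipticCurves.ModularForms
  Literature.NumberTheory.EllipticCurves.Rank1Residual
  Literature.NumberTheory.EllipticCurves.KrizLi2019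
  Literature.NumberTheory.GaloisCohomology
  Summit.BirchSwinnertonDyer.Rank1Residual
  Summit.BirchSwinnertonDyer.Rank1Residual.Additive
  Summit.BirchSwinnertonDyer.Rank1Residual.X11b
  Summit.BirchSwinnertonDyer.Rank1Residual.X11b.AcSelmer
  Summit.BirchSwinnertonDyer.Rank1Residual.X11b.Halves
  Summit.BirchSwinnertonDyer.BirchSwinnertonDyer.Theses.SemiOrdinaryEisensteinDescent

/-- **Item `EisensteinKernelAtThreeTowerFreeOdd` (stmt-BirchSwinnertonDyer-24697) of route
`SemiOrdinaryEisensteinDescent` holds**: `PublishedInputsWildThree → WildSplitEisensteinInclusionAtThreeRestricted →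
WildKolyvaginUpperAtThreeTowerFree → WildSplitPrintedInputsAtThree → WildSplitFrameAtThreeOddOfPrint →
PoitouTateSelmerStructureDualityFact → WildRankZeroTwistAtThree ⟹ WAllExclAddWildRankOneSurj` — Jetchev–Skinner–Wan's
§7.4 assembly at the wild split `3` WITHOUT tower split: Friedberg–Hoffstein field (`2` and all of `N(E)` split, odd
`d_K ≠ -3`), Heegner point, Gross–Zagier, Kolyvagin, frame `(κ, γ, 𝔭, 𝔭′)`, `R₀`-frame at `𝔭` from print with its
unit value forced by LZZ, `≤`-control at `𝔭′` from Poitou–Tate duality, restricted Eisenstein inclusion at the frame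
⟹ lower socket, tower-free Kolyvagin crux ⟹ upper socket, both at slack `v₃(c)` ⟹ p528981 with the rank-zero leaf.
Every crux / fact is an antecedent; BSD is not proved by this.
[cite: JetchevSkinnerWan2017, Thm. 3.3.1 and §7.4.1 (arXiv:1512.06894 pp. 11, 30)]
[cite: LiuZhangZhang2018, Thm 1.5.1 and Thm 1.5.3 (Duke Math. J. 167 pp. 748–749)] [cite: MilneADT2006, Ch. I, Thm. 4.10(b)]
[cite: GrossZagier1986, Thm. I.(6.3) and V.§2] [cite: FriedbergHoffstein1995, Thm. B] -/
theorem semiOrdinaryEisensteinDescent_eisensteinKernelAtThreeTowerFreeOdd_proof :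
    EisensteinKernelAtThreeTowerFreeOdd := by
  unfold EisensteinKernelAtThreeTowerFreeOdd Summit.BirchSwinnertonDyer.WAllExclAddWildRankOneSurj
  intro hF hE' hKoly hW hS hPT hZ W _ _ hncm hO6 hsurj hr
  obtain ⟨hH, hB, hLZZ⟩ := hW
  obtain ⟨hGZ, hKo, hGZK, hmod, hmodP, -, hGZ73, hFH, hpar, hHP⟩ := hF
  haveI hN0 : NeZero (W.conductorNorm ℤ) := ⟨W.conductorNorm_pos_holds.ne'⟩
  -- (a) DATA. parity: `r_an = 1` is odd, so `w(E) = -1`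
  have hw : W.rootNumber = -1 := by
    rcases W.rootNumber_eq_one_or with h | h
    · exfalso
      have heven : Even W.analyticRank := (hpar W).mpr h
      rw [hr] at heven
      exact Nat.not_even_one heven
    · exact h
  -- Friedberg–Hoffstein with auxiliary modulus `2`: Heegner for `N(E)`, `2` split, `L(E^{(d_K)},1) ≠ 0`
  obtain ⟨K, _, _, hK, -, hHN, hH2, hLt⟩ := hFH W hw 2 two_ne_zero 0
  have hodd : Odd (NumberField.discr K) := by
    have h8 := Literature.SatisfiesHeegnerHypothesis.discr_emod_eight hK.1 hH2 (dvd_refl 2)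
    rw [Int.odd_iff]; omega
  -- `3 ∣ N(E)` (additive) splits in `K`; hence `d_K ≠ -3`
  have h3N : 3 ∣ W.conductorNorm ℤ :=
    (W.dvd_conductorNorm_iff_not_hasGoodReductionAtPrime 3).mpr (not_good_of_addv W 3 hO6.2.1)
  have hsplit : SplitsIn K 3 := hHN 3 Nat.prime_three h3N
  have hd3 : NumberField.discr K ≠ -3 := by
    intro h
    exact Literature.SatisfiesHeegnerHypothesis.not_dvd_discr hK.1 hHN Nat.prime_three h3N
      (by rw [h]; norm_num)
  -- the Heegner point over `K` and its datum; non-torsion by Gross–Zagier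
  obtain ⟨P, Dt, H, ι, hP⟩ := hHP W K hK hHN
  have hL0 : W.entireLFunction 1 = 0 := entireLFunction_one_eq_zero_of_analyticRank_eq_one hr
  obtain ⟨-, hderiv⟩ := leadingLCoeff_eq_deriv_of_analyticRank_eq_one hr
  have hLK : LDerivEK W K ≠ 0 := by
    rw [lDerivEK_eq_deriv_mul W K hmod hL0]; exact mul_ne_zero hderiv hLt
  have hnt : ¬ IsOfFinAddOrder P :=
    (lDerivEK_ne_zero_iff_not_isOfFinAddOrder W (W.conductorNorm ℤ) K (hGZ _ W K) hK hHN
      ⟨Dt, H, ι, hP⟩).mp hLK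
  -- Kolyvagin: `rank E(K) = 1`, `Ш(E/K)` finite
  obtain ⟨hrk, hfin⟩ := hKo (W.conductorNorm ℤ) W K hK hHN ⟨Dt, H, ι, hP⟩ hnt
  -- a frame `(κ, γ, 𝔭)` and the other prime `𝔭′ ≠ 𝔭` above `3`
  obtain ⟨κ, γ, -, hκ, hγ, -⟩ := X11b.exists_anticyclotomic_generator_prime (p := 3) hK
  haveI : Fact (κ.IsTopGenerator γ) := ⟨hγ⟩
  obtain ⟨𝔭, h𝔭, he, hf⟩ := X11b.exists_degreeOnePrime_of_splitsIn K 3 hK.1 hsplit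
  obtain ⟨𝔭', hne, h𝔭', he', hf'⟩ := X11b.Three.exists_ne_degreeOne_prime hK.1 h𝔭 he hf
  -- (b) PLUMBING. the `R₀`-frame at `(κ, γ, 𝔭)` over the Friedberg–Hoffstein field (odd `d_K`) FROM PRINT (Hsieh ∧ BDP13 feed
  -- the frame item), and its unit value, FORCED by the LZZ input (p594734 §1)
  obtain ⟨ι', hind, ΩK, Ωp, L, hΩK, hΩp, hBDP⟩ :=
    hS hH hB W (W.conductorNorm ℤ) K Dt hO6 rfl hK hHN hodd κ hκ γ 𝔭 h𝔭
  obtain ⟨u, hval⟩ := EisensteinKernelAtThreeRestrictedOfFrameOdd.exists_unit_hasValueAt_of_frame hLZZ W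
    (W.conductorNorm ℤ) K Dt H ι P hO6 rfl hK hHN hP hnt κ hκ γ 𝔭 h𝔭 he hf ι' hind hΩK hΩp hBDP
  -- the control INEQUALITY at `𝔭′` at slack `0` (CTL₀ included), from Poitou–Tate duality for Selmer structures ALONE
  -- (p593079 §2; Kolyvagin's theorem for the datum from the published inputs)
  have hctl : SchneiderFreeControlAtoms.AdditiveControlLeOnTreeAt 3 κ 𝔭' γ (embAt K 3 𝔭' h𝔭' he' hf') 0 P :=
    AdditiveRankOneControlLe.additiveControlLeOnTreeAt_of_poitouTate_of_heegner W 3 (by norm_num) hO6.2.1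
      (W.conductorNorm ℤ) K (hPT K) Dt H ι P rfl hK hHN hP hnt (hKo _ W K) κ hκ γ 𝔭' h𝔭' he' hf'
  obtain ⟨n, hn, hnle⟩ := hctl
  -- the value read through the logarithm at `𝔭′` (rank one: `(log_{𝔭′} P)² = (log_𝔭 P)²`)
  have hval' : L.HasValueAt 0 ((((u : unrIntegers 3) : unrIntegers 3) : ℂ_[3]) *
      (algebraMap ℚ_[3] ℂ_[3]
        (logOmega W 3 (embAt K 3 𝔭' h𝔭' he' hf') P / (Dt.c : ℚ_[3]))) ^ 2) :=
    (SchneiderFreeAdditiveX3.hasValueAt_sq_logOmega_embAt_iff_of_rank_one W 3 hK.1 hrk h𝔭 he hf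
      h𝔭' he' hf' P _ _ L).mpr hval
  -- the LOWER socket at slack `v₃(c)` at the frame `(κ, 𝔭′, γ, embAt 𝔭′)` — from crux #2′
  have hc0 : Dt.c ≠ 0 := Dt.maninConstant_ne_zero_holds
  have hlog : logOmega W 3 (embAt K 3 𝔭' h𝔭' he' hf') P ≠ 0 := X11b.R1.logOmega_ne_zero W 3 _ hnt
  have hlow : SchneiderFree.AdditiveIMCLowerBDPOnTreeLeAt 3 κ 𝔭' γ (embAt K 3 𝔭' h𝔭' he' hf')
      (padicValNat 3 Dt.c.natAbs) P := by
    obtain ⟨htors, f, hfI, hf0, hfn⟩ := hn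
    -- the RESTRICTED EISENSTEIN INCLUSION `Ch_Λ(X_(∅,0))·R₀⟦T⟧ ⊆ (L)` at the frame (crux #2′ by name, torsion-guarded),
    -- fed WITH the datum the kernel holds here (`H, ι, P`, `L(E^{(d_K)},1) ≠ 0`, `P = y_K`, `P` non-torsion)
    have hincl : (XAc.charIdeal (W.baseChange K) 3 κ 𝔭' ∅ γ).map (PowerSeries.map (toUnr 3)) ≤ Ideal.span {L} :=
      hE' W (W.conductorNorm ℤ) K Dt H ι P hO6 hsurj hr rfl hK hHN hLt hP hnt κ hκ γ 𝔭 h𝔭 he hf 𝔭' h𝔭' hne ι' hind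
        ΩK Ωp L hΩK hΩp hBDP htors
    have hmem : PowerSeries.map (toUnr 3) f ∈ Ideal.span {L} := by
      rw [hfI, CongruenceLimit.map_span_singleton_powerSeries] at hincl
      exact (Ideal.span_singleton_le_iff_mem _).mp hincl
    obtain ⟨-, hle⟩ := Supersingular.two_mul_valuation_le_of_mem_span 3 hf0 hmem u hval'
    have hc0' : (Dt.c : ℚ_[3]) ≠ 0 := by exact_mod_cast hc0
    rw [div_eq_mul_inv, Padic.valuation_mul hlog (inv_ne_zero hc0'), Padic.valuation_inv,
      Padic.valuation_intCast, valuation_logOmega hlog, hfn] at hle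
    refine ⟨n, ⟨htors, f, hfI, hf0, hfn⟩, ?_⟩
    simp only [padicValInt] at hle
    linarith
  -- STEP L at the Manin slack: the link consumes control ONLY as `≤` (utd-p3 g6, p593079 §3)
  have hlo : SchneiderFree.IndexLowerBoundLeAt W 3 K P (padicValNat 3 Dt.c.natAbs) :=
    AdditiveRankOneControlLe.indexLowerBoundLeAt_of_imcLowerLe_of_controlLe_zero rfl hK hHN hfin hlow
      ⟨n, hn, hnle⟩
  -- the UPPER socket at slack `v₃(c)` IS the TOWER-FREE Kolyvagin crux `Ko′` (`d_K` odd, `≠ -3`; onto mod `3` only)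
  have hupI : SchneiderFree.Upper.IndexUpperBoundLeAt W 3 K P (padicValNat 3 Dt.c.natAbs) :=
    hKoly W (W.conductorNorm ℤ) K Dt H ι P hO6 hsurj hr rfl hK hHN hLt hP hnt hodd hd3
  -- (c) TERMINAL STEP: a globally minimal model of the twist, then p528981
  have hD0 : (NumberField.discr K : ℚ) ≠ 0 := by exact_mod_cast NumberField.discr_ne_zero K
  haveI : (W.quadraticTwist (NumberField.discr K : ℚ)).IsElliptic := W.isElliptic_quadraticTwist hD0
  obtain ⟨Cd, hCd⟩ := hasGlobalMinimalModel_rat_holds (W.quadraticTwist (NumberField.discr K : ℚ))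
  haveI : (Cd • W.quadraticTwist (NumberField.discr K : ℚ)).IsGloballyMinimal := hCd
  exact SchneiderFree.Exact.bsdp_three_of_exactIndexManin_of_wAllExclAddWildRankZero hGZ hKo hGZK hmod
    hGZ73 hZ W hO6 hsurj hr (W.conductorNorm ℤ) K Dt H ι P
    (Cd • W.quadraticTwist (NumberField.discr K : ℚ)) rfl hK hodd hHN hLt hP ⟨Cd, rfl⟩ hlo hupI

end Summit.BirchSwinnertonDyer.BirchSwinnertonDyer.Theorems

end
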